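import Summits.SmoothPoincare4.SmoothPoincare4.Theses.EntropyRung
import Summits.SmoothPoincare4.SmoothPoincare4.Theorems.EntropyRungSubcylindricalExistenceConformalGluingSchwarzschild
import Summits.SmoothPoincare4.SmoothPoincare4.Theorems.EntropyRungSubcylindricalExistenceConformalGluing
import Summits.SmoothPoincare4.SmoothPoincare4.Theorems.EntropyRungSubcylindricalExistenceConformalRealisation
import Summits.SmoothPoincare4.SmoothPoincare4.Theorems.EntropyRungSubcylindricalExistenceCapFactorSchwarzschild
import Summits.SmoothPoincare4.SmoothPoincare4.Theorems.EntropyRungSubcylindricalExistenceCapMetricVolumeSchwarzschild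
import Summits.SmoothPoincare4.SmoothPoincare4.Theorems.EntropyRungSubcylindricalExistenceGluingCutoffBoundSchwarzschild
import Summits.SmoothPoincare4.SmoothPoincare4.Theorems.EntropyRungSubcylindricalExistenceCapClauseEuclideanSchwarzschild
import Summits.SmoothPoincare4.SmoothPoincare4.Theorems.EntropyRungSubcylindricalExistenceSphereSideClauseSchwarzschild
import HarnessLib

/-!
# The REDUCTION of the crux `EntropyRung.SubcylindricalExistence` to the transfer stub Â_b of line
# `green-blowup-conformal-entropy`, reshape R-c3 "Schwarzschild gauge" (stmt-SmoothPoincare4-10871, lead c3)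

`subcylindricalExistence_of_schwarzschildBlowupExistence` (registered as `helper_schwarzschildReduction`):
the crux BY NAME from ONE hypothesis, the registered transfer stub `stub_schwarzschildBlowupExistence`
(Â_b: every closed smooth homotopy 4-sphere carries Green data in the flat gauge WITH MASS —
`G(φ⁻¹y) = a/‖y − y₀‖² + b` on the flat chart ball, `b ≥ 0` constant — whose blow-up clears
`ν_cyl + δ`; SPC4-hard given the rung, NOT asserted here), composing the landed C
(`GreenBlowupReduction.conformalLaplacianSolve`), D' (`stub_conformalGluingSchwarzschild`, fed the
landed worker stubs S3' `stub_capFactorSchwarzschild`, S5' `stub_capMetricVolumeSchwarzschild`, Cut'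
`stub_cutoffSqIntegralSchwarzschild`, S2'M `stub_sphereSideClauseSchwarzschild` ∘ E2
`stub_capClauseEuclideanSchwarzschild`) and E (`stub_conformalRealisation`).
(That Â_b is formally WEAKER than lead c2's exact-gauge stub A‴ — `b = 0` — is
`schwarzschildBlowupExistence_of_blowupExistence` in `…ConformalGluingSchwarzschild.lean`.)
Everything is proved; no definitions, no named facts; the reduction is CONDITIONAL on Â_b only.
-/

noncomputable section

set_option linter.dupNamespace false

open scoped Manifold ContDiff Topology RealInnerProductSpace ContinuousMap
open Set Filter MeasureTheory
open Literature.Geometry.Lorentzian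

namespace Summit.SmoothPoincare4.SmoothPoincare4.Theorems

/-- **ENT from blow-up existence in the flat gauge with mass** (line `green-blowup-conformal-entropy`,
reshape R-c3): if every closed smooth homotopy 4-sphere carries Green data in the Schwarzschild gauge whose
blow-up clears `ν_cyl + δ` (the registered transfer stub `stub_schwarzschildBlowupExistence`, hypothesis
`hA`), then `EntropyRung.SubcylindricalExistence` holds. Composition of the landed C, D' (fed S3', S5',
Cut', S2'M ∘ E2) and E; pure logic. [cite: LeeParker1987, §§5–7] -/
theorem subcylindricalExistence_of_schwarzschildBlowupExistence
    (hA : ∀ (M : Type) [TopologicalSpace M] [T2Space M] [SecondCountableTopology M]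
      [ChartedSpace (EuclideanSpace ℝ (Fin 4)) M] [IsManifold (𝓡 4) ∞ M] [CompactSpace M]
      [T3Space M] [MeasurableSpace M] [BorelSpace M],
      M ≃ₕ Metric.sphere (0 : EuclideanSpace ℝ (Fin 5)) 1 →
      ∃ g : PseudoRiemannianMetric (𝓡 4) ∞ (EuclideanSpace ℝ (Fin 4)) (TangentSpace (𝓡 4) : M → Type _),
      ∃ _ : g.HasLeviCivita, ∃ hg : g.IsRiemannian, ∃ p : M, ∃ G : M → ℝ, ∃ a b r : ℝ,
        (ContMDiffOn (𝓡 4) 𝓘(ℝ, ℝ) ∞ G {p}ᶜ ∧ (∀ x, x ≠ p → 0 < G x) ∧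
          (∀ x, x ≠ p → g.scalarCurvature x * G x - 6 * g.dalembertian G x = 0) ∧
          Tendsto G (𝓝[≠] p) atTop) ∧
        (∀ x, 0 ≤ g.scalarCurvature x) ∧
        (∀ x, g.scalarCurvature x = 0 → x ∈ (extChartAt (𝓡 4) p).source ∧
          extChartAt (𝓡 4) p x ∈ Metric.closedBall (extChartAt (𝓡 4) p p) r) ∧
        0 < a ∧ 0 ≤ b ∧ 0 < r ∧
        (Metric.closedBall (extChartAt (𝓡 4) p p) r ⊆ (extChartAt (𝓡 4) p).target ∧
          ∀ y ∈ Metric.closedBall (extChartAt (𝓡 4) p p) r, ∀ X W : EuclideanSpace ℝ (Fin 4),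
          g.val ((extChartAt (𝓡 4) p).symm y)
            (mfderiv 𝓘(ℝ, EuclideanSpace ℝ (Fin 4)) (𝓡 4) (extChartAt (𝓡 4) p).symm y X)
            (mfderiv 𝓘(ℝ, EuclideanSpace ℝ (Fin 4)) (𝓡 4) (extChartAt (𝓡 4) p).symm y W) = ⟪X, W⟫) ∧
        (∀ y ∈ Metric.closedBall (extChartAt (𝓡 4) p p) r, y ≠ extChartAt (𝓡 4) p p →
          G ((extChartAt (𝓡 4) p).symm y) = a / ‖y - extChartAt (𝓡 4) p p‖ ^ 2 + b) ∧
        ∃ δ : ℝ, 0 < δ ∧ ∀ τ : ℝ, 0 < τ → ∀ w : M → ℝ, ContMDiff (𝓡 4) 𝓘(ℝ, ℝ) ∞ w →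
          w =ᶠ[𝓝 p] 0 →
          ∫ x, (4 * Real.pi * τ) ^ (-(4 : ℝ) / 2) * (w x) ^ 2 * (G x) ^ 4
              ∂(riemannianMeasure (g.toContMDiffRiemannianMetric hg)) = 1 →
            Real.log 2 + Real.log Real.pi / 2 - 3 / 2 + δ ≤
              ∫ x, (4 * τ * ((G x)⁻¹ ^ 2 * g.gradSq w x) - (w x) ^ 2 * Real.log ((w x) ^ 2)
                  - 4 * (w x) ^ 2) * ((4 * Real.pi * τ) ^ (-(4 : ℝ) / 2) * (G x) ^ 4)
                ∂(riemannianMeasure (g.toContMDiffRiemannianMetric hg))) :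
    Summit.SmoothPoincare4.SmoothPoincare4.Theses.EntropyRung.SubcylindricalExistence := by
  intro M _ _ _ _ _ _ _ _ _ e
  -- Â_b (hypothesis): Green data in the flat gauge with mass at `p`, super-cylindrical blow-up
  obtain ⟨g, hLC, hg, p, G, a, b, r, hGreen, hR0, hRzero, ha, hb, hr, hFlat, hGform, hBlow⟩ := hA M e
  -- C (landed): `L_g` is positively invertible
  have hSolve := GreenBlowupReduction.conformalLaplacianSolve M e g hg p G hGreen
  -- D' (landed, fed S3', S5', Cut', S2'M ∘ E2): the conformally-round-capped factor `ψ`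
  obtain ⟨ψ, hψ, hψpos, hLψ, hW⟩ :=
    stub_conformalGluingSchwarzschild stub_capFactorSchwarzschild stub_capMetricVolumeSchwarzschild
      stub_cutoffSqIntegralSchwarzschild
      (stub_sphereSideClauseSchwarzschild stub_capClauseEuclideanSchwarzschild)
      M e g hg p G a b r hGreen hR0 hRzero ha hb hr hFlat hGform hBlow hSolve
  -- E (landed): realise `ψ² g` and read off `R > 0` and the crux's clause at level `ν_cyl`
  obtain ⟨g', hLC', hg', -, hR', hν'⟩ :=
    stub_conformalRealisation M g hg ψ hψ hψpos hLψ (Real.log 2 + Real.log Real.pi / 2 - 3 / 2) hW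
  exact ⟨g', hLC', hg', hR', hν'⟩

/-- Registered helper `helper_schwarzschildReduction` of crux stmt-SmoothPoincare4-10871 (the reduction
above, as the registered signature: the transfer stub `stub_schwarzschildBlowupExistence` implies the
crux). [cite: LeeParker1987, §§5–7] -/
theorem helper_schwarzschildReduction :
    (∀ (M : Type) [TopologicalSpace M] [T2Space M] [SecondCountableTopology M]
      [ChartedSpace (EuclideanSpace ℝ (Fin 4)) M] [IsManifold (𝓡 4) ∞ M] [CompactSpace M]
      [T3Space M] [MeasurableSpace M] [BorelSpace M],
      M ≃ₕ Metric.sphere (0 : EuclideanSpace ℝ (Fin 5)) 1 →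
      ∃ g : PseudoRiemannianMetric (𝓡 4) ∞ (EuclideanSpace ℝ (Fin 4)) (TangentSpace (𝓡 4) : M → Type _),
      ∃ _ : g.HasLeviCivita, ∃ hg : g.IsRiemannian, ∃ p : M, ∃ G : M → ℝ, ∃ a b r : ℝ,
        (ContMDiffOn (𝓡 4) 𝓘(ℝ, ℝ) ∞ G {p}ᶜ ∧ (∀ x, x ≠ p → 0 < G x) ∧
          (∀ x, x ≠ p → g.scalarCurvature x * G x - 6 * g.dalembertian G x = 0) ∧
          Tendsto G (𝓝[≠] p) atTop) ∧
        (∀ x, 0 ≤ g.scalarCurvature x) ∧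
        (∀ x, g.scalarCurvature x = 0 → x ∈ (extChartAt (𝓡 4) p).source ∧
          extChartAt (𝓡 4) p x ∈ Metric.closedBall (extChartAt (𝓡 4) p p) r) ∧
        0 < a ∧ 0 ≤ b ∧ 0 < r ∧
        (Metric.closedBall (extChartAt (𝓡 4) p p) r ⊆ (extChartAt (𝓡 4) p).target ∧
          ∀ y ∈ Metric.closedBall (extChartAt (𝓡 4) p p) r, ∀ X W : EuclideanSpace ℝ (Fin 4),
          g.val ((extChartAt (𝓡 4) p).symm y)
            (mfderiv 𝓘(ℝ, EuclideanSpace ℝ (Fin 4)) (𝓡 4) (extChartAt (𝓡 4) p).symm y X)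
            (mfderiv 𝓘(ℝ, EuclideanSpace ℝ (Fin 4)) (𝓡 4) (extChartAt (𝓡 4) p).symm y W) = ⟪X, W⟫) ∧
        (∀ y ∈ Metric.closedBall (extChartAt (𝓡 4) p p) r, y ≠ extChartAt (𝓡 4) p p →
          G ((extChartAt (𝓡 4) p).symm y) = a / ‖y - extChartAt (𝓡 4) p p‖ ^ 2 + b) ∧
        ∃ δ : ℝ, 0 < δ ∧ ∀ τ : ℝ, 0 < τ → ∀ w : M → ℝ, ContMDiff (𝓡 4) 𝓘(ℝ, ℝ) ∞ w →
          w =ᶠ[𝓝 p] 0 →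
          ∫ x, (4 * Real.pi * τ) ^ (-(4 : ℝ) / 2) * (w x) ^ 2 * (G x) ^ 4
              ∂(riemannianMeasure (g.toContMDiffRiemannianMetric hg)) = 1 →
            Real.log 2 + Real.log Real.pi / 2 - 3 / 2 + δ ≤
              ∫ x, (4 * τ * ((G x)⁻¹ ^ 2 * g.gradSq w x) - (w x) ^ 2 * Real.log ((w x) ^ 2)
                  - 4 * (w x) ^ 2) * ((4 * Real.pi * τ) ^ (-(4 : ℝ) / 2) * (G x) ^ 4)
                ∂(riemannianMeasure (g.toContMDiffRiemannianMetric hg))) →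
    Summit.SmoothPoincare4.SmoothPoincare4.Theses.EntropyRung.SubcylindricalExistence :=
  fun hA ↦ subcylindricalExistence_of_schwarzschildBlowupExistence hA

end Summit.SmoothPoincare4.SmoothPoincare4.Theorems

end
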